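import Mathlib
import HarnessLib
import Summits.ValiantsHypothesis.ValiantsHypothesis.Theorems.LacunarySymmetroidMatrixDescartesProductPlusOneRowTowerKCalculus

/-!
# LINE (A) `product_plus_one` — the θ-tower as CUMULANTS of the rate distribution, and the COHERENT WINDOW LAW (every support size)

Companion of ✓ `…RowTowerKDefs` / ✓ `…RowTowerKCalculus` (stripped row `A − Σ_l B_l x^{λ_l}`, `u = rowUK`, `H_k = rowHK`, `ψ₁ = rowPsiK1`, `ψ₃ = rowPsiK3`).
Put unit mass on the rates: weight `A·u` at rate `0` and `w_l = (−B_l x^{λ_l})·u` at rate `λ_l` (total mass `1` where the row does not vanish;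
mean rate `M = −H₁u`).  Then

* §0 invariances: `rowPsiK1_neg`/`rowPsiK3_neg` (flip all signs), `rowPsiK1/3_congr_support` (idle rates are invisible) and the cloud law read on
  the support `rowPsiK3_gt_support`;
* §1 `rowPsiK1_eq_neg_variance`: `ψ₁ = −(Σ_l w_l (λ_l − M)² + A u·M²)` (minus the variance), and the ★ CUMULANT CERTIFICATE
  `rowPsiK3_cumulant_certificate`: `ψ₃ − p²ψ₁ − 3ψ₁² = Σ_l w_l (λ_l − M)²(p² − (λ_l − M)²) + A u·M²(p² − M²)` (pure identities, any signs, any real `p`);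
* §2 ★ the COHERENT WINDOW LAW `rowPsiK3_coherent_law`: if `A ≥ 0`, every `B_l ≤ 0` (all coefficients of the row of one sign), `x > 0`, and the active
  rates (rate `0` counted when `A ≠ 0`) lie in a window `[β, β + p]`, then `p²ψ₁ + 3ψ₁² ≤ ψ₃`; hence `p²ψ₁ ≤ ψ₃`, STRICT as soon as `ψ₁ ≠ 0`
  (`rowPsiK1_neg_of_coherent`: two distinct active rates ⇒ `ψ₁ < 0`).  This is the multi-knee companion of the cloud law ✓ `rowPsiK3_ge`
  (there: `B ≥ 0`, rates `≥ p`); together they feed the row-law engine ✓ `wronskianK_roots_le_two_of_rowLaws` at any threshold.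

Honest framing: calculus of rows (helpers); nothing closes a stub; `OneChangeFloorK3` / `WronskianBudgetK3` / 18050 / `MatrixDescartes` OPEN; `VP ≠ VNP` NOT proved.
No definitions, no named facts.
-/

set_option linter.dupNamespace false

namespace Summit.ValiantsHypothesis.ValiantsHypothesis.Theorems.LacunarySymmetroidMatrixDescartes

namespace ProductPlusOne

open Finset
open scoped BigOperators

variable {n : ℕ} (lam : Fin n → ℕ) (A : ℝ) (B : Fin n → ℝ)

/-! ### §0 Two invariances of the tower: flipping all signs, and changing idle rates -/

/-- `H_k(−B) = −H_k(B)`. [this file's lemma] -/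
theorem rowHK_neg (k : ℕ) (x : ℝ) : rowHK lam k (fun l => -B l) x = -rowHK lam k B x := by
  unfold rowHK
  rw [← Finset.sum_neg_distrib]
  exact Finset.sum_congr rfl fun l _ => by ring

/-- `u(−A, −B) = −u(A, B)`. [this file's lemma] -/
theorem rowUK_neg (x : ℝ) : rowUK lam (-A) (fun l => -B l) x = -rowUK lam A B x := by
  unfold rowUK
  have : -A - ∑ l, -B l * x ^ lam l = -(A - ∑ l, B l * x ^ lam l) := by
    rw [Finset.sum_congr rfl fun l _ => (neg_mul (B l) (x ^ lam l)), Finset.sum_neg_distrib]; ring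
  rw [this, inv_neg]

/-- `ψ₁` is invariant under flipping all signs of the row (`W(−f) = W(f)`). [this file's lemma] -/
theorem rowPsiK1_neg (x : ℝ) : rowPsiK1 lam (-A) (fun l => -B l) x = rowPsiK1 lam A B x := by
  unfold rowPsiK1
  rw [rowHK_neg, rowHK_neg, rowUK_neg]
  ring

/-- `ψ₃` is invariant under flipping all signs of the row. [this file's lemma] -/
theorem rowPsiK3_neg (x : ℝ) : rowPsiK3 lam (-A) (fun l => -B l) x = rowPsiK3 lam A B x := by
  unfold rowPsiK3
  rw [rowHK_neg, rowHK_neg, rowHK_neg, rowHK_neg, rowUK_neg]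
  ring

/-- The stripped row flips sign with the row. [this file's lemma] -/
theorem row_neg (x : ℝ) : -A - ∑ l, -B l * x ^ (lam l) = -(A - ∑ l, B l * x ^ (lam l)) := by
  rw [Finset.sum_congr rfl fun l _ => (neg_mul (B l) (x ^ lam l)), Finset.sum_neg_distrib]; ring

/-- `H_k` only sees the rates of ACTIVE letters: changing `λ_l` where `B_l = 0` changes nothing. [this file's lemma] -/
theorem rowHK_congr_support {lam' : Fin n → ℕ} (h : ∀ l, B l ≠ 0 → lam' l = lam l) (k : ℕ) (x : ℝ) :
    rowHK lam' k B x = rowHK lam k B x := by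
  unfold rowHK
  refine Finset.sum_congr rfl fun l _ => ?_
  rcases eq_or_ne (B l) 0 with h0 | h0
  · rw [h0]; simp
  · rw [h l h0]

/-- The stripped row only sees the rates of active letters. [this file's lemma] -/
theorem row_congr_support {lam' : Fin n → ℕ} (h : ∀ l, B l ≠ 0 → lam' l = lam l) (x : ℝ) :
    A - ∑ l, B l * x ^ (lam' l) = A - ∑ l, B l * x ^ (lam l) := by
  congr 1
  refine Finset.sum_congr rfl fun l _ => ?_
  rcases eq_or_ne (B l) 0 with h0 | h0
  · rw [h0]; simp
  · rw [h l h0]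

/-- `u` only sees the rates of active letters. [this file's lemma] -/
theorem rowUK_congr_support {lam' : Fin n → ℕ} (h : ∀ l, B l ≠ 0 → lam' l = lam l) (x : ℝ) :
    rowUK lam' A B x = rowUK lam A B x := by
  unfold rowUK
  rw [row_congr_support lam A B h]

/-- `ψ₁` only sees the rates of active letters. [this file's lemma] -/
theorem rowPsiK1_congr_support {lam' : Fin n → ℕ} (h : ∀ l, B l ≠ 0 → lam' l = lam l) (x : ℝ) :
    rowPsiK1 lam' A B x = rowPsiK1 lam A B x := by
  unfold rowPsiK1
  rw [rowHK_congr_support lam B h, rowHK_congr_support lam B h, rowUK_congr_support lam A B h]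

/-- `ψ₃` only sees the rates of active letters. [this file's lemma] -/
theorem rowPsiK3_congr_support {lam' : Fin n → ℕ} (h : ∀ l, B l ≠ 0 → lam' l = lam l) (x : ℝ) :
    rowPsiK3 lam' A B x = rowPsiK3 lam A B x := by
  unfold rowPsiK3
  rw [rowHK_congr_support lam B h, rowHK_congr_support lam B h, rowHK_congr_support lam B h, rowHK_congr_support lam B h,
    rowUK_congr_support lam A B h]

/-- ★ **THE CLOUD LAW with rates read on the support only**: `B ≥ 0`, unswitched, `x > 0`, every ACTIVE rate `≥ p`, `H₁ > 0` ⇒ `p²ψ₁ < ψ₃`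
(✓ `rowPsiK3_gt` after moving the idle rates above `p`). [this file's theorem] -/
theorem rowPsiK3_gt_support (p : ℕ) {x : ℝ} (hx : 0 < x) (hB : ∀ l, 0 ≤ B l) (hlam : ∀ l, B l ≠ 0 → p ≤ lam l)
    (hF : 0 < A - ∑ l, B l * x ^ (lam l)) (hH1 : 0 < rowHK lam 1 B x) :
    (p : ℝ) ^ 2 * rowPsiK1 lam A B x < rowPsiK3 lam A B x := by
  classical
  set lam' : Fin n → ℕ := fun l => if B l = 0 then p else lam l with hlam'
  have h : ∀ l, B l ≠ 0 → lam' l = lam l := fun l hl => by simp [hlam', hl]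
  have hge : ∀ l, p ≤ lam' l := fun l => by
    by_cases hl : B l = 0
    · simp [hlam', hl]
    · simp only [hlam', hl, if_false]; exact hlam l hl
  rw [← rowPsiK1_congr_support lam A B h, ← rowPsiK3_congr_support lam A B h]
  refine rowPsiK3_gt lam' A B p hx hB hge ?_ ?_
  · rwa [row_congr_support lam A B h]
  · rwa [rowHK_congr_support lam B h]

/-! ### §1 Mass, moments, variance, and the cumulant certificate -/

/-- Total mass one: `A·u + Σ_l (−B_l x^{λ_l})·u = 1` where the row does not vanish. [this file's lemma] -/
theorem rateWeights_sum_eq_one {x : ℝ} (hF : A - ∑ l, B l * x ^ (lam l) ≠ 0) :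
    A * rowUK lam A B x + ∑ l, (-(B l * x ^ (lam l))) * rowUK lam A B x = 1 := by
  unfold rowUK
  rw [← Finset.sum_mul, ← add_mul]
  have : A + ∑ l, -(B l * x ^ lam l) = A - ∑ l, B l * x ^ lam l := by
    rw [Finset.sum_neg_distrib]; ring
  rw [this]
  exact mul_inv_cancel₀ hF

/-- Moments: `Σ_l λ_l^k·(−B_l x^{λ_l})u = −H_k·u`. [this file's lemma] -/
theorem rateWeights_moment (k : ℕ) (x : ℝ) :
    ∑ l, ((lam l : ℕ) : ℝ) ^ k * ((-(B l * x ^ (lam l))) * rowUK lam A B x) = -(rowHK lam k B x * rowUK lam A B x) := by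
  unfold rowHK
  rw [Finset.sum_mul, ← Finset.sum_neg_distrib]
  exact Finset.sum_congr rfl fun l _ => by ring

/-- The zeroth moment: `−H₀u = 1 − A u`. [this file's lemma] -/
theorem neg_rowHK_zero_mul_rowUK {x : ℝ} (hF : A - ∑ l, B l * x ^ (lam l) ≠ 0) :
    -(rowHK lam 0 B x * rowUK lam A B x) = 1 - A * rowUK lam A B x := by
  rw [← rateWeights_moment lam A B 0 x]
  have h1 := rateWeights_sum_eq_one lam A B hF
  have : ∑ l, ((lam l : ℕ) : ℝ) ^ 0 * ((-(B l * x ^ (lam l))) * rowUK lam A B x)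
      = ∑ l, (-(B l * x ^ (lam l))) * rowUK lam A B x := Finset.sum_congr rfl fun l _ => by ring
  rw [this]
  linarith

/-- ★ `ψ₁ = −Var`: `ψ₁ = −(Σ_l w_l (λ_l − M)² + A u·M²)` with `w_l = (−B_l x^{λ_l})u`, `M = −H₁u`. [this file's theorem] -/
theorem rowPsiK1_eq_neg_variance {x : ℝ} (hF : A - ∑ l, B l * x ^ (lam l) ≠ 0) :
    rowPsiK1 lam A B x
      = -(∑ l, (-(B l * x ^ (lam l))) * rowUK lam A B x * (((lam l : ℕ) : ℝ) - -(rowHK lam 1 B x * rowUK lam A B x)) ^ 2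
          + A * rowUK lam A B x * (-(rowHK lam 1 B x * rowUK lam A B x)) ^ 2) := by
  have hexp : ∑ l, (-(B l * x ^ (lam l))) * rowUK lam A B x * (((lam l : ℕ) : ℝ) - -(rowHK lam 1 B x * rowUK lam A B x)) ^ 2
      = ∑ l, ((lam l : ℕ) : ℝ) ^ 2 * ((-(B l * x ^ (lam l))) * rowUK lam A B x)
        - 2 * (-(rowHK lam 1 B x * rowUK lam A B x)) * ∑ l, ((lam l : ℕ) : ℝ) ^ 1 * ((-(B l * x ^ (lam l))) * rowUK lam A B x)
        + (-(rowHK lam 1 B x * rowUK lam A B x)) ^ 2 * ∑ l, ((lam l : ℕ) : ℝ) ^ 0 * ((-(B l * x ^ (lam l))) * rowUK lam A B x) := by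
    rw [Finset.mul_sum, Finset.mul_sum, ← Finset.sum_sub_distrib, ← Finset.sum_add_distrib]
    exact Finset.sum_congr rfl fun l _ => by ring
  rw [hexp, rateWeights_moment lam A B 1 x, rateWeights_moment lam A B 2 x, rateWeights_moment lam A B 0 x,
    neg_rowHK_zero_mul_rowUK lam A B hF]
  unfold rowPsiK1
  ring

/-- ★ **THE CUMULANT CERTIFICATE** (pure identity, any signs, any real `p`):
`ψ₃ − p²ψ₁ − 3ψ₁² = Σ_l w_l (λ_l − M)²(p² − (λ_l − M)²) + A u·M²(p² − M²)`. [this file's theorem] -/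
theorem rowPsiK3_cumulant_certificate (p : ℝ) {x : ℝ} (hF : A - ∑ l, B l * x ^ (lam l) ≠ 0) :
    rowPsiK3 lam A B x - p ^ 2 * rowPsiK1 lam A B x - 3 * rowPsiK1 lam A B x ^ 2
      = ∑ l, (-(B l * x ^ (lam l))) * rowUK lam A B x
            * ((((lam l : ℕ) : ℝ) - -(rowHK lam 1 B x * rowUK lam A B x)) ^ 2
              * (p ^ 2 - (((lam l : ℕ) : ℝ) - -(rowHK lam 1 B x * rowUK lam A B x)) ^ 2))
        + A * rowUK lam A B x * ((-(rowHK lam 1 B x * rowUK lam A B x)) ^ 2 * (p ^ 2 - (-(rowHK lam 1 B x * rowUK lam A B x)) ^ 2)) := by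
  set M : ℝ := -(rowHK lam 1 B x * rowUK lam A B x) with hM
  have hexp : ∑ l, (-(B l * x ^ (lam l))) * rowUK lam A B x * ((((lam l : ℕ) : ℝ) - M) ^ 2 * (p ^ 2 - (((lam l : ℕ) : ℝ) - M) ^ 2))
      = (p ^ 2 - 6 * M ^ 2) * ∑ l, ((lam l : ℕ) : ℝ) ^ 2 * ((-(B l * x ^ (lam l))) * rowUK lam A B x)
        - (2 * M * p ^ 2 - 4 * M ^ 3) * ∑ l, ((lam l : ℕ) : ℝ) ^ 1 * ((-(B l * x ^ (lam l))) * rowUK lam A B x)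
        + (M ^ 2 * p ^ 2 - M ^ 4) * ∑ l, ((lam l : ℕ) : ℝ) ^ 0 * ((-(B l * x ^ (lam l))) * rowUK lam A B x)
        + 4 * M * ∑ l, ((lam l : ℕ) : ℝ) ^ 3 * ((-(B l * x ^ (lam l))) * rowUK lam A B x)
        - ∑ l, ((lam l : ℕ) : ℝ) ^ 4 * ((-(B l * x ^ (lam l))) * rowUK lam A B x) := by
    rw [Finset.mul_sum, Finset.mul_sum, Finset.mul_sum, Finset.mul_sum, ← Finset.sum_sub_distrib, ← Finset.sum_add_distrib,
      ← Finset.sum_add_distrib, ← Finset.sum_sub_distrib]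
    exact Finset.sum_congr rfl fun l _ => by ring
  rw [hexp, rateWeights_moment lam A B 1 x, rateWeights_moment lam A B 2 x, rateWeights_moment lam A B 0 x,
    rateWeights_moment lam A B 3 x, rateWeights_moment lam A B 4 x, neg_rowHK_zero_mul_rowUK lam A B hF]
  have hM' : rowHK lam 1 B x * rowUK lam A B x = -M := by rw [hM, neg_neg]
  unfold rowPsiK3 rowPsiK1
  rw [show rowHK lam 1 B x ^ 2 * rowUK lam A B x ^ 2 = (rowHK lam 1 B x * rowUK lam A B x) ^ 2 by ring,
    show 12 * rowHK lam 1 B x ^ 2 * rowHK lam 2 B x * rowUK lam A B x ^ 3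
      = 12 * (rowHK lam 1 B x * rowUK lam A B x) ^ 2 * (rowHK lam 2 B x * rowUK lam A B x) by ring,
    show 6 * rowHK lam 1 B x ^ 4 * rowUK lam A B x ^ 4 = 6 * (rowHK lam 1 B x * rowUK lam A B x) ^ 4 by ring,
    show (4 * rowHK lam 1 B x * rowHK lam 3 B x + 3 * rowHK lam 2 B x ^ 2) * rowUK lam A B x ^ 2
      = 4 * (rowHK lam 1 B x * rowUK lam A B x) * (rowHK lam 3 B x * rowUK lam A B x) + 3 * (rowHK lam 2 B x * rowUK lam A B x) ^ 2 by ring,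
    hM']
  ring

/-! ### §2 The coherent window law -/

/-- The weights of a coherent row are non-negative: `B_l ≤ 0`, `x > 0`, `u > 0` ⇒ `0 ≤ (−B_l x^{λ_l})u`. [this file's lemma] -/
theorem rateWeight_nonneg {x : ℝ} (hx : 0 < x) (hB : ∀ l, B l ≤ 0) (hF : 0 < A - ∑ l, B l * x ^ (lam l)) (l : Fin n) :
    0 ≤ (-(B l * x ^ (lam l))) * rowUK lam A B x := by
  have hu := rowUK_pos lam A B hF
  have : 0 ≤ -(B l * x ^ (lam l)) := by
    have := mul_nonpos_of_nonpos_of_nonneg (hB l) (pow_pos hx (lam l)).le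
    linarith
  exact mul_nonneg this hu.le

/-- The mean rate of a coherent row lies in the window: active rates (and `0` if `A ≠ 0`) in `[β, β+p]` ⇒ `β ≤ M ≤ β + p`. [this file's lemma] -/
theorem meanRate_mem_window (p β : ℝ) {x : ℝ} (hx : 0 < x) (hA : 0 ≤ A) (hB : ∀ l, B l ≤ 0)
    (h0 : A ≠ 0 → β ≤ 0 ∧ 0 ≤ β + p) (hwin : ∀ l, B l ≠ 0 → β ≤ ((lam l : ℕ) : ℝ) ∧ ((lam l : ℕ) : ℝ) ≤ β + p)
    (hF : 0 < A - ∑ l, B l * x ^ (lam l)) :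
    β ≤ -(rowHK lam 1 B x * rowUK lam A B x) ∧ -(rowHK lam 1 B x * rowUK lam A B x) ≤ β + p := by
  have hu := rowUK_pos lam A B hF
  have h1 := rateWeights_sum_eq_one lam A B hF.ne'
  have hm1 := rateWeights_moment lam A B 1 x
  have hw := rateWeight_nonneg lam A B hx hB hF
  -- `M − β = Σ_l w_l (λ_l − β) + A u (0 − β)` and `β + p − M = Σ_l w_l (β + p − λ_l) + A u (β + p − 0)`
  have hlow : -(rowHK lam 1 B x * rowUK lam A B x) - β
      = ∑ l, (-(B l * x ^ (lam l))) * rowUK lam A B x * (((lam l : ℕ) : ℝ) - β) + A * rowUK lam A B x * (0 - β) := by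
    rw [← hm1]
    have : ∑ l, (-(B l * x ^ (lam l))) * rowUK lam A B x * (((lam l : ℕ) : ℝ) - β)
        = ∑ l, ((lam l : ℕ) : ℝ) ^ 1 * ((-(B l * x ^ (lam l))) * rowUK lam A B x)
          - β * ∑ l, (-(B l * x ^ (lam l))) * rowUK lam A B x := by
      rw [Finset.mul_sum, ← Finset.sum_sub_distrib]
      exact Finset.sum_congr rfl fun l _ => by ring
    rw [this]
    linear_combination β * h1
  have hup : β + p - -(rowHK lam 1 B x * rowUK lam A B x)
      = ∑ l, (-(B l * x ^ (lam l))) * rowUK lam A B x * (β + p - ((lam l : ℕ) : ℝ)) + A * rowUK lam A B x * (β + p - 0) := by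
    rw [← hm1]
    have : ∑ l, (-(B l * x ^ (lam l))) * rowUK lam A B x * (β + p - ((lam l : ℕ) : ℝ))
        = (β + p) * ∑ l, (-(B l * x ^ (lam l))) * rowUK lam A B x
          - ∑ l, ((lam l : ℕ) : ℝ) ^ 1 * ((-(B l * x ^ (lam l))) * rowUK lam A B x) := by
      rw [Finset.mul_sum, ← Finset.sum_sub_distrib]
      exact Finset.sum_congr rfl fun l _ => by ring
    rw [this]
    linear_combination (-(β + p)) * h1
  have hA0 : ∀ c : ℝ, (A ≠ 0 → 0 ≤ c) → 0 ≤ A * rowUK lam A B x * c := by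
    intro c hc
    rcases eq_or_ne A 0 with h | h
    · rw [h]; simp
    · exact mul_nonneg (mul_nonneg hA hu.le) (hc h)
  have hterm : ∀ l (c : ℝ), (B l ≠ 0 → 0 ≤ c) → 0 ≤ (-(B l * x ^ (lam l))) * rowUK lam A B x * c := by
    intro l c hc
    rcases eq_or_ne (B l) 0 with h | h
    · rw [h]; simp
    · exact mul_nonneg (hw l) (hc h)
  constructor
  · rw [← sub_nonneg, hlow]
    exact add_nonneg (Finset.sum_nonneg fun l _ => hterm l _ fun h => by linarith [(hwin l h).1])
      (hA0 _ fun h => by linarith [(h0 h).1])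
  · rw [← sub_nonneg, hup]
    exact add_nonneg (Finset.sum_nonneg fun l _ => hterm l _ fun h => by linarith [(hwin l h).2])
      (hA0 _ fun h => by linarith [(h0 h).2])

/-- ★ **THE COHERENT WINDOW LAW for every K**: a row with all coefficients of one sign (`A ≥ 0`, every `B_l ≤ 0`, `x > 0`, row non-vanishing) whose
active rates (and `0`, if the bottom letter is active) lie in a window `[β, β + p]` has `p²ψ₁ + 3ψ₁² ≤ ψ₃`. [this file's theorem] -/
theorem rowPsiK3_coherent_law (p β : ℝ) {x : ℝ} (hx : 0 < x) (hA : 0 ≤ A) (hB : ∀ l, B l ≤ 0)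
    (h0 : A ≠ 0 → β ≤ 0 ∧ 0 ≤ β + p) (hwin : ∀ l, B l ≠ 0 → β ≤ ((lam l : ℕ) : ℝ) ∧ ((lam l : ℕ) : ℝ) ≤ β + p)
    (hF : 0 < A - ∑ l, B l * x ^ (lam l)) :
    p ^ 2 * rowPsiK1 lam A B x + 3 * rowPsiK1 lam A B x ^ 2 ≤ rowPsiK3 lam A B x := by
  have hu := rowUK_pos lam A B hF
  have hw := rateWeight_nonneg lam A B hx hB hF
  obtain ⟨hMl, hMu⟩ := meanRate_mem_window lam A B p β hx hA hB h0 hwin hF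
  set M : ℝ := -(rowHK lam 1 B x * rowUK lam A B x) with hM
  have hcert := rowPsiK3_cumulant_certificate lam A B p hF.ne'
  rw [← hM] at hcert
  have hsq : ∀ t : ℝ, β ≤ t → t ≤ β + p → 0 ≤ (t - M) ^ 2 * (p ^ 2 - (t - M) ^ 2) := by
    intro t ht1 ht2
    have : 0 ≤ p ^ 2 - (t - M) ^ 2 := by nlinarith
    positivity
  have hS : 0 ≤ ∑ l, (-(B l * x ^ (lam l))) * rowUK lam A B x * ((((lam l : ℕ) : ℝ) - M) ^ 2 * (p ^ 2 - (((lam l : ℕ) : ℝ) - M) ^ 2)) := by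
    refine Finset.sum_nonneg fun l _ => ?_
    rcases eq_or_ne (B l) 0 with h | h
    · rw [h]; simp
    · exact mul_nonneg (hw l) (hsq _ (hwin l h).1 (hwin l h).2)
  have hT : 0 ≤ A * rowUK lam A B x * (M ^ 2 * (p ^ 2 - M ^ 2)) := by
    rcases eq_or_ne A 0 with h | h
    · rw [h]; simp
    · have h00 := hsq 0 (h0 h).1 (h0 h).2
      have : (0 - M) ^ 2 * (p ^ 2 - (0 - M) ^ 2) = M ^ 2 * (p ^ 2 - M ^ 2) := by ring
      rw [this] at h00
      exact mul_nonneg (mul_nonneg hA hu.le) h00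
  linarith

/-- (coherent law, weak form) `p²ψ₁ ≤ ψ₃`. [this file's lemma] -/
theorem rowPsiK3_ge_of_coherent (p β : ℝ) {x : ℝ} (hx : 0 < x) (hA : 0 ≤ A) (hB : ∀ l, B l ≤ 0)
    (h0 : A ≠ 0 → β ≤ 0 ∧ 0 ≤ β + p) (hwin : ∀ l, B l ≠ 0 → β ≤ ((lam l : ℕ) : ℝ) ∧ ((lam l : ℕ) : ℝ) ≤ β + p)
    (hF : 0 < A - ∑ l, B l * x ^ (lam l)) :
    p ^ 2 * rowPsiK1 lam A B x ≤ rowPsiK3 lam A B x := by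
  have h := rowPsiK3_coherent_law lam A B p β hx hA hB h0 hwin hF
  nlinarith [sq_nonneg (rowPsiK1 lam A B x)]

/-- ★ (coherent law, strict form) `ψ₁ ≠ 0 ⇒ p²ψ₁ < ψ₃`. [this file's theorem] -/
theorem rowPsiK3_gt_of_coherent (p β : ℝ) {x : ℝ} (hx : 0 < x) (hA : 0 ≤ A) (hB : ∀ l, B l ≤ 0)
    (h0 : A ≠ 0 → β ≤ 0 ∧ 0 ≤ β + p) (hwin : ∀ l, B l ≠ 0 → β ≤ ((lam l : ℕ) : ℝ) ∧ ((lam l : ℕ) : ℝ) ≤ β + p)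
    (hF : 0 < A - ∑ l, B l * x ^ (lam l)) (hψ : rowPsiK1 lam A B x ≠ 0) :
    p ^ 2 * rowPsiK1 lam A B x < rowPsiK3 lam A B x := by
  have h := rowPsiK3_coherent_law lam A B p β hx hA hB h0 hwin hF
  have : 0 < rowPsiK1 lam A B x ^ 2 := by positivity
  linarith

/-- ★ **two distinct active rates ⇒ `ψ₁ < 0`** for a coherent row (`A ≥ 0`, `B ≤ 0`, `x > 0`): either two tail letters `l ≠ l'` with `B_l, B_{l'} ≠ 0` and
`λ_l ≠ λ_{l'}`, or the bottom letter (`A ≠ 0`) and a tail letter with `λ_l ≠ 0`. [this file's theorem] -/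
theorem rowPsiK1_neg_of_coherent {x : ℝ} (hx : 0 < x) (hA : 0 ≤ A) (hB : ∀ l, B l ≤ 0)
    (hF : 0 < A - ∑ l, B l * x ^ (lam l))
    (hact : (∃ l l', B l ≠ 0 ∧ B l' ≠ 0 ∧ lam l ≠ lam l') ∨ (A ≠ 0 ∧ ∃ l, B l ≠ 0 ∧ lam l ≠ 0)) :
    rowPsiK1 lam A B x < 0 := by
  have hu := rowUK_pos lam A B hF
  have hw := rateWeight_nonneg lam A B hx hB hF
  rw [rowPsiK1_eq_neg_variance lam A B hF.ne', neg_lt_zero]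
  set M : ℝ := -(rowHK lam 1 B x * rowUK lam A B x) with hM
  have hwpos : ∀ l, B l ≠ 0 → 0 < (-(B l * x ^ (lam l))) * rowUK lam A B x := by
    intro l h
    have hBl : B l < 0 := lt_of_le_of_ne (hB l) h
    have : 0 < -(B l * x ^ (lam l)) := by
      have := mul_neg_of_neg_of_pos hBl (pow_pos hx (lam l))
      linarith
    exact mul_pos this hu
  have hterm : ∀ l, 0 ≤ (-(B l * x ^ (lam l))) * rowUK lam A B x * (((lam l : ℕ) : ℝ) - M) ^ 2 := fun l =>
    mul_nonneg (hw l) (sq_nonneg _)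
  have hT : 0 ≤ A * rowUK lam A B x * M ^ 2 := mul_nonneg (mul_nonneg hA hu.le) (sq_nonneg _)
  have hSge : ∀ l, (-(B l * x ^ (lam l))) * rowUK lam A B x * (((lam l : ℕ) : ℝ) - M) ^ 2
      ≤ ∑ l', (-(B l' * x ^ (lam l'))) * rowUK lam A B x * (((lam l' : ℕ) : ℝ) - M) ^ 2 := fun l =>
    Finset.single_le_sum (fun l' _ => hterm l') (Finset.mem_univ l)
  rcases hact with ⟨l, l', hl, hl', hne⟩ | ⟨hA0, l, hl, hl0⟩
  · -- one of `λ_l, λ_{l'}` differs from `M`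
    have hne' : ((lam l : ℕ) : ℝ) ≠ ((lam l' : ℕ) : ℝ) := by exact_mod_cast hne
    rcases eq_or_ne (((lam l : ℕ) : ℝ)) M with h1 | h1
    · have h2 : ((lam l' : ℕ) : ℝ) - M ≠ 0 := by rw [← h1]; exact sub_ne_zero.2 hne'.symm
      have hpos : 0 < (-(B l' * x ^ (lam l'))) * rowUK lam A B x * (((lam l' : ℕ) : ℝ) - M) ^ 2 :=
        mul_pos (hwpos l' hl') (by positivity)
      linarith [hSge l']
    · have h2 : ((lam l : ℕ) : ℝ) - M ≠ 0 := sub_ne_zero.2 h1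
      have hpos : 0 < (-(B l * x ^ (lam l))) * rowUK lam A B x * (((lam l : ℕ) : ℝ) - M) ^ 2 :=
        mul_pos (hwpos l hl) (by positivity)
      linarith [hSge l]
  · rcases eq_or_ne M 0 with h1 | h1
    · have h2 : ((lam l : ℕ) : ℝ) - M ≠ 0 := by
        rw [h1, sub_zero]; exact_mod_cast hl0
      have hpos : 0 < (-(B l * x ^ (lam l))) * rowUK lam A B x * (((lam l : ℕ) : ℝ) - M) ^ 2 :=
        mul_pos (hwpos l hl) (by positivity)
      linarith [hSge l]
    · have hApos : 0 < A := lt_of_le_of_ne hA (Ne.symm hA0)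
      have hpos : 0 < A * rowUK lam A B x * M ^ 2 := mul_pos (mul_pos hApos hu) (by positivity)
      linarith [hSge l, hterm l]

end ProductPlusOne

end Summit.ValiantsHypothesis.ValiantsHypothesis.Theorems.LacunarySymmetroidMatrixDescartes
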